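import Literature.Probability.Percolation.ClusterExtremalPoints
import Literature.Probability.Percolation.RSW

/-!
# Stub `stub_incrementBound` (line `registered`, crux `SimilarityUpgrade`, stmt-CriticalPhenomena-4597)

Crux `Summit.CriticalPhenomena.CardyFormulaZ2.Theses.CardyWhiteToColoured.SimilarityUpgrade`,
line `registered` (skeleton `Cruxes/SimilarityUpgrade/Lines/birth.lean`), stub **A1**
`stub_incrementBound`: the discrete increment bound for the box-crossing probabilities of
critical bond percolation on `ℤ²`,

`crossingProb ½ m k - crossingProb ½ (m + j) k ≤ C j (k + 1) / s² + C ((j + s) / m) ^ α`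

(`K ≤ s ≤ m`, `K (j + s) ≤ m`), from the deterministic extraction T1 (on `LR(m,k) ∖ LR(m+j,k)`
some site `p` of the column strip `[m, m+j) × [0, k]`, joined inside the big box to its left side,
is a `(1,0)`-local top at every admissible scale) and the corner one-arm bound T2, both taken as
hypotheses, together with the tree bound `real_localTopEvent_le`
(`P(localTopEvent u x s) ≤ C / s²`, `ClusterExtremalPoints.lean`).

Proof: union bound. Up to the null set of non-lattice configurations (`ae_subset_edgeSet`),
`LR(m,k) ⊆ LR(m+j,k) ∪ Corner ∪ ⋃_{p} localTopEvent (1,0) p s`, the union over the `j (k+1)`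
sites of the strip (indexed by `Finset.range j ×ˢ Finset.range (k+1)`); then
`measureReal_union_le`, `measureReal_biUnion_finset_le`.

References: P. Nolin, *Near-critical percolation in two dimensions*, EJP 13 (2008), §5.2, proof
of Thm 23 (arXiv numbering) [Nolin2008]; O. Schramm, S. Smirnov, *On the scaling limits of planar
percolation*, Ann. Probab. 39 (2011), Lemma 6.1 [SchrammSmirnov2011].
-/

noncomputable section

namespace Summit.CriticalPhenomena.CardyFormulaZ2.Cruxes.SimilarityUpgrade.Stubs

open MeasureTheory Set
open Literature.Probability.Percolation
open Literature.Probability.LatticeModels (Site zdGraph)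

/-- **stub_incrementBound (A1).** `crossingProb half m k - crossingProb half (m+j) k` is at most
the probability of `LR(m,k) ∖ LR(m+j,k)`; by T1 (first hypothesis) this event lies, up to the null
set of non-lattice configurations, in the union of the corner event of T2 (second hypothesis) and
of the local-top events `localTopEvent (1,0) p s` over the `j (k+1)` sites `p` of the strip
`[m, m+j) × [0, k]`, each of probability `≤ C/s²` (`real_localTopEvent_le`).
[cite: Nolin2008, §5.2 proof of Thm 23] -/
theorem stub_incrementBound :
    (∀ (ω : BondConfig (Site 2)), ω ⊆ (zdGraph 2).edgeSet →
      ∀ (m j k : ℕ), ω ∈ lrCrossing m k → ω ∉ lrCrossing (m + j) k →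
        ∃ p : Site 2, (m : ℤ) ≤ p 0 ∧ p 0 < m + j ∧ 0 ≤ p 1 ∧ p 1 ≤ k ∧
          (∃ u ∈ (leftSide (m + j) k : Set (Site 2)),
            ω ∈ openConnIn (↑(rectangle (m + j) k) : Set (Site 2)) u p) ∧
          ∀ s : ℕ, 1 ≤ s → s ≤ m → (s : ℤ) ≤ p 1 → p 1 + s ≤ k →
            IsLocalTop ![(1 : ℝ), 0] ω p s) →
    (∃ C α : ℝ, 0 < C ∧ 0 < α ∧ ∃ K : ℕ, 1 ≤ K ∧ ∀ (m j k s : ℕ), K ≤ j + s → K * (j + s) ≤ m →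
      (bondPercolation (zdGraph 2) half).real
        {ω | ∃ p : Site 2, (m : ℤ) ≤ p 0 ∧ p 0 < m + j ∧ 0 ≤ p 1 ∧ p 1 ≤ k ∧
          (p 1 < s ∨ (k : ℤ) < p 1 + s) ∧
          ∃ u ∈ (leftSide (m + j) k : Set (Site 2)),
            ω ∈ openConnIn (↑(rectangle (m + j) k) : Set (Site 2)) u p}
        ≤ C * (((j : ℝ) + s) / m) ^ α) →
    ∃ C α : ℝ, 0 < C ∧ 0 < α ∧ ∃ K : ℕ, 1 ≤ K ∧ ∀ (m j k s : ℕ), K ≤ s → K * (j + s) ≤ m →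
      s ≤ m → 2 * s ≤ k →
      crossingProb half m k - crossingProb half (m + j) k ≤
        C * ((j : ℝ) * ((k : ℝ) + 1) / (s : ℝ) ^ 2) + C * (((j : ℝ) + s) / m) ^ α := by
  intro h1 h2
  obtain ⟨Ct, hCt, s₀, hs₀, ht⟩ := real_localTopEvent_le
  obtain ⟨Cc, α, hCc, hα, Kc, hKc, hc⟩ := h2
  refine ⟨max Ct Cc, α, lt_max_of_lt_left hCt, hα, max (max Kc s₀) 1, le_max_right _ _,
    fun m j k s hKs hKm hsm _hsk => ?_⟩
  -- the thresholds
  have hKcK : Kc ≤ max (max Kc s₀) 1 := le_trans (le_max_left _ _) (le_max_left _ _)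
  have hKc_s : Kc ≤ s := hKcK.trans hKs
  have hs₀_s : s₀ ≤ s := le_trans (le_trans (le_max_right _ _) (le_max_left _ _)) hKs
  have h1s : 1 ≤ s := le_trans (le_max_right _ _) hKs
  have hKc1 : Kc ≤ j + s := hKc_s.trans (Nat.le_add_left s j)
  have hKc2 : Kc * (j + s) ≤ m := le_trans (Nat.mul_le_mul_right _ hKcK) hKm
  -- notation
  set μ := bondPercolation (zdGraph 2) half with hμ
  set Corner : Set (BondConfig (Site 2)) :=
    {ω | ∃ p : Site 2, (m : ℤ) ≤ p 0 ∧ p 0 < m + j ∧ 0 ≤ p 1 ∧ p 1 ≤ k ∧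
      (p 1 < s ∨ (k : ℤ) < p 1 + s) ∧
      ∃ u ∈ (leftSide (m + j) k : Set (Site 2)),
        ω ∈ openConnIn (↑(rectangle (m + j) k) : Set (Site 2)) u p} with hCorner
  set Q : Finset (ℕ × ℕ) := Finset.range j ×ˢ Finset.range (k + 1) with hQ
  set site : ℕ × ℕ → Site 2 := fun q => ![(m : ℤ) + q.1, (q.2 : ℤ)] with hsite
  set Tops : Set (BondConfig (Site 2)) := ⋃ q ∈ Q, localTopEvent ![(1 : ℝ), 0] (site q) s
    with hTops
  -- STEP 1: `LR(m,k) ⊆ LR(m+j,k) ∪ (Corner ∪ Tops)` almost surely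
  have hincl : μ.real (lrCrossing m k) ≤ μ.real (lrCrossing (m + j) k ∪ (Corner ∪ Tops)) := by
    refine ENNReal.toReal_mono (measure_ne_top _ _) (measure_mono_ae ?_)
    filter_upwards [ae_subset_edgeSet (zdGraph 2) half] with ω hω hA
    by_cases hB : ω ∈ lrCrossing (m + j) k
    · exact Or.inl hB
    right
    obtain ⟨p, hp0, hp0', hp1, hp1', hu, htop⟩ := h1 ω hω m j k hA hB
    by_cases hcor : p 1 < s ∨ (k : ℤ) < p 1 + s
    · exact Or.inl ⟨p, hp0, hp0', hp1, hp1', hcor, hu⟩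
    · right
      push Not at hcor
      have hlt : IsLocalTop ![(1 : ℝ), 0] ω p s := htop s h1s hsm hcor.1 hcor.2
      obtain ⟨a, ha⟩ : ∃ a : ℕ, p 0 = m + a := ⟨(p 0 - m).toNat, by omega⟩
      obtain ⟨b, hb⟩ : ∃ b : ℕ, p 1 = b := ⟨(p 1).toNat, by omega⟩
      have hpq : p = site (a, b) := by
        ext i
        fin_cases i
        · simpa [hsite] using ha
        · simpa [hsite] using hb
      have hq : (a, b) ∈ Q := by
        simp only [hQ, Finset.mem_product, Finset.mem_range]
        constructor <;> omega
      rw [hTops]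
      refine Set.mem_iUnion₂.2 ⟨(a, b), hq, ?_⟩
      show IsLocalTop ![(1 : ℝ), 0] ω (site (a, b)) s
      rwa [← hpq]
  -- STEP 2: measures
  have hcorner : μ.real Corner ≤ Cc * (((j : ℝ) + s) / m) ^ α := hc m j k s hKc1 hKc2
  have htops : μ.real Tops ≤ (j : ℝ) * ((k : ℝ) + 1) * (Ct / (s : ℝ) ^ 2) := by
    calc μ.real Tops ≤ ∑ q ∈ Q, μ.real (localTopEvent ![(1 : ℝ), 0] (site q) s) :=
          measureReal_biUnion_finset_le _ _
      _ ≤ ∑ q ∈ Q, Ct / (s : ℝ) ^ 2 :=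
          Finset.sum_le_sum fun q _ => ht _ _ _ hs₀_s
      _ = (j : ℝ) * ((k : ℝ) + 1) * (Ct / (s : ℝ) ^ 2) := by
          rw [Finset.sum_const, hQ, Finset.card_product, Finset.card_range, Finset.card_range,
            nsmul_eq_mul]
          push_cast
          ring
  have hX : 0 ≤ (((j : ℝ) + s) / m) ^ α := Real.rpow_nonneg (by positivity) _
  have hY : 0 ≤ (j : ℝ) * ((k : ℝ) + 1) / (s : ℝ) ^ 2 := by positivity
  have hCt' : Ct ≤ max Ct Cc := le_max_left _ _
  have hCc' : Cc ≤ max Ct Cc := le_max_right _ _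
  have h3 : (j : ℝ) * ((k : ℝ) + 1) * (Ct / (s : ℝ) ^ 2) ≤
      max Ct Cc * ((j : ℝ) * ((k : ℝ) + 1) / (s : ℝ) ^ 2) := by
    rw [show (j : ℝ) * ((k : ℝ) + 1) * (Ct / (s : ℝ) ^ 2) =
      Ct * ((j : ℝ) * ((k : ℝ) + 1) / (s : ℝ) ^ 2) by ring]
    exact mul_le_mul_of_nonneg_right hCt' hY
  have h4 : Cc * (((j : ℝ) + s) / m) ^ α ≤ max Ct Cc * (((j : ℝ) + s) / m) ^ α :=
    mul_le_mul_of_nonneg_right hCc' hX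
  have hunion := measureReal_union_le (μ := μ) (lrCrossing (m + j) k) (Corner ∪ Tops)
  have hunion' := measureReal_union_le (μ := μ) Corner Tops
  calc crossingProb half m k - crossingProb half (m + j) k
      = μ.real (lrCrossing m k) - μ.real (lrCrossing (m + j) k) := rfl
    _ ≤ μ.real Corner + μ.real Tops := by linarith
    _ ≤ max Ct Cc * ((j : ℝ) * ((k : ℝ) + 1) / (s : ℝ) ^ 2) +
        max Ct Cc * (((j : ℝ) + s) / m) ^ α := by linarith

end Summit.CriticalPhenomena.CardyFormulaZ2.Cruxes.SimilarityUpgrade.Stubs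

end
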